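import Literature.MathematicalPhysics.QuantumFieldTheory.Balaban1983to89.B10
import HarnessLib

/-!
# Crux `HistoryTailL` (stmt-QuantumFields-19936) — line «entropy-floor», PLAN «pinned (41)»: THE REAL-ANALYSIS DOOR
# `stub_superpolyDoor` (STUB D of `Cruxes/HistoryTailL/Lines/entropy_floor_planPinned41.lean`, plan v1.1), PROVED with an explicit constant

Cell `ym3-torus` (YM ladder rung R3 = continuum `SU(2)` Yang–Mills on the three-torus — a RUNG: NOT d = 4, NOT infinite volume, NOT a
mass gap, NOT the Clay problem).  Width seat `ym3-torus-px8` g10; helper `--supports stmt-QuantumFields-19936` (★★OWNER WORD 47 (iv):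
«`stub_superpolyDoor` (S–M, provable now) is FREE TO TAKE by name … supports 19936 as helper today»; WORD 48 (i): this seat's pen;
WORD 48 (iii): the exponent letter is `exp(−c·p²)` for ANY `c > 0`, never the literal `¼` — plan v1.1 of ideator `ym-r3-idea-2` g16).
THEOREMS ONLY, def-free.

WHAT IS PROVED.  Bałaban's per-plaquette large-field factor at distance `s` from the unit scale, `g_s^{−N}·exp(−c·p(g_s)²)` with
`g_s = √(γ·L^{−s})`, `p(g) = b₀(1 + log g⁻¹)^{p₀}` ([Balaban1985UV3] (7) p. 257, (70)–(71) p. 273; tree `B10.pFun`; the tree-reachable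
exponent constant is `c = c₁/8`, ✓`UV3PinnedLargeFieldResummation.largeField_pinned_of_resummation`), is bounded by `A·(L⁻⁴)^s`
UNIFORMLY IN `s` — for `0 < γ ≤ 1 < L`, `0 < b₀`, `1 ≤ p₀`, `0 < c` — with the EXPLICIT constant `A = exp((N + 8)²/(4c·b₀²))`
(`superpolyDoor_explicit`), whence the plan's STUB D text VERBATIM (`stub_superpolyDoor`, which asks `2 < p₀`).
Proof (one page): put `t := log g_s⁻¹ ≥ 0` (as `g_s ≤ 1`); then `g_s^{−(N+8)} = e^{(N+8)t}`, `(L⁻⁴)^s = (g_s²/γ)⁴ ≥ g_s⁸`, and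
`p(g_s) = b₀(1+t)^{p₀} ≥ b₀(1+t)` (`1 + t ≥ 1`, `p₀ ≥ 1`), so the claim reduces to `(N+8)t − c·b₀²(1+t)² ≤ (N+8)²/(4c·b₀²)`, i.e. to
`(2c·b₀²(1+t) − (N+8))² ≥ 0`.  The exponent `2p₀ > 4` of the plan is slack here: any `p₀ ≥ 1` beats every power of `L^s`.

HONEST SCOPE.  Real analysis about the printed profile only; it proves NO stub of the registered lines, NOT `stub_pinnedRatio`/`hP`
(the Gibbs-probability form of (41)/(71), not printed), NOT `EntropyFloor.stub_geometricTail`, NOT `HistoryTailL`; nothing of rung R3 or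
the mass gap.  With `stub_pinnedRatioEF` it yields the floor stub by the plan's sorry-free `geometricTail_of_pinnedEF`.
References: T. Bałaban, CMP **102** (1985) 255–275 [Balaban1985UV3], (7) p. 257 and (70)–(71) p. 273.
-/

set_option autoImplicit false

noncomputable section

open Literature.MathematicalPhysics.QuantumFieldTheory.Balaban1983to89

namespace Summit.QuantumFields.YangMills.Theorems.EntropyFloorSuperpolyDoor

/-- **The square-completion step**: for `0 < b`, `0 ≤ M` and any real `t`, `M·t − b·(1+t)² ≤ M²/(4b)`
(from `(2b(1+t) − M)² ≥ 0` and `M·t ≤ M·(1+t)`). [folklore] -/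
theorem linear_sub_sq_le {b t M : ℝ} (hb : 0 < b) (hM : 0 ≤ M) :
    M * t - b * (1 + t) ^ 2 ≤ M ^ 2 / (4 * b) := by
  have hb4 : 0 < 4 * b := by positivity
  rw [le_div_iff₀ hb4]
  have h1 : M * t * (4 * b) ≤ M * (1 + t) * (4 * b) := by
    have : M * t ≤ M * (1 + t) := by nlinarith
    exact mul_le_mul_of_nonneg_right this hb4.le
  nlinarith [sq_nonneg (2 * b * (1 + t) - M), h1]

/-- **Bałaban's profile dominates its linear part**: for `0 < b₀`, `1 ≤ p₀` and `0 < g ≤ 1`,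
`b₀·(1 + log g⁻¹) ≤ p(g) = b₀(1 + log g⁻¹)^{p₀}` (the base `1 + log g⁻¹` is `≥ 1`). [cite: Balaban1985UV3, (7) p.257] -/
theorem mul_one_add_log_le_pFun {b₀ p₀ g : ℝ} (hb₀ : 0 < b₀) (hp₀ : 1 ≤ p₀) (hg : 0 < g) (hg1 : g ≤ 1) :
    b₀ * (1 + Real.log g⁻¹) ≤ B10.pFun b₀ p₀ g := by
  unfold B10.pFun
  have ht : 0 ≤ Real.log g⁻¹ := Real.log_nonneg (one_le_inv_iff₀.mpr ⟨hg, hg1⟩)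
  have hu : (1 : ℝ) ≤ 1 + Real.log g⁻¹ := by linarith
  have key : (1 + Real.log g⁻¹) ^ (1 : ℝ) ≤ (1 + Real.log g⁻¹) ^ p₀ :=
    Real.rpow_le_rpow_of_exponent_le hu hp₀
  rw [Real.rpow_one] at key
  exact mul_le_mul_of_nonneg_left key hb₀.le

/-- ★★ **THE DOOR WITH AN EXPLICIT CONSTANT.**  For `1 < L`, `0 < γ ≤ 1`, `0 < b₀`, `1 ≤ p₀`, `0 < c`, every `N : ℕ` and every `s : ℕ`:
`(√(γL^{−s}))^{−N} · exp(−c·p(√(γL^{−s}))²) ≤ exp((N+8)²/(4c·b₀²)) · (L⁻⁴)^s`.  [cite: Balaban1985UV3, (7) p.257 and (70)-(71) p.273] -/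
theorem superpolyDoor_explicit (L : ℕ) (hL : 1 < L) (γ b₀ p₀ c : ℝ) (hγ : 0 < γ) (hγ1 : γ ≤ 1) (hb₀ : 0 < b₀) (hp₀ : 1 ≤ p₀)
    (hc : 0 < c) (N s : ℕ) :
    (Real.sqrt (γ * ((L : ℝ)⁻¹) ^ s))⁻¹ ^ N * Real.exp (-(c * B10.pFun b₀ p₀ (Real.sqrt (γ * ((L : ℝ)⁻¹) ^ s)) ^ 2))
      ≤ Real.exp (((N : ℝ) + 8) ^ 2 / (4 * (c * b₀ ^ 2))) * (((L : ℝ) ^ 4)⁻¹) ^ s := by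
  have hL0 : (0 : ℝ) < (L : ℝ) := by exact_mod_cast (zero_lt_one.trans hL)
  have hL1 : (1 : ℝ) ≤ (L : ℝ) := by exact_mod_cast hL.le
  set q : ℝ := γ * ((L : ℝ)⁻¹) ^ s with hq
  have hLinv : (0 : ℝ) < ((L : ℝ)⁻¹) := inv_pos.mpr hL0
  have hLinv1 : ((L : ℝ)⁻¹) ≤ 1 := inv_le_one_of_one_le₀ hL1
  have hq0 : 0 < q := mul_pos hγ (pow_pos hLinv s)
  have hq1 : q ≤ 1 := by
    have : ((L : ℝ)⁻¹) ^ s ≤ 1 := pow_le_one₀ hLinv.le hLinv1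
    calc q = γ * ((L : ℝ)⁻¹) ^ s := rfl
      _ ≤ 1 * 1 := mul_le_mul hγ1 this (pow_pos hLinv s).le zero_le_one
      _ = 1 := one_mul 1
  set g : ℝ := Real.sqrt q with hgdef
  have hg0 : 0 < g := Real.sqrt_pos.mpr hq0
  have hg1 : g ≤ 1 := Real.sqrt_le_one.mpr hq1
  have hgsq : g ^ 2 = q := Real.sq_sqrt hq0.le
  -- `t := log g⁻¹ ≥ 0`, `g⁻¹ = e^t`
  set t : ℝ := Real.log g⁻¹ with htdef
  have ht0 : 0 ≤ t := Real.log_nonneg (one_le_inv_iff₀.mpr ⟨hg0, hg1⟩)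
  have hginv : g⁻¹ = Real.exp t := by rw [htdef, Real.exp_log (inv_pos.mpr hg0)]
  -- the linear lower bound on the profile and its square
  have hp1 : b₀ * (1 + t) ≤ B10.pFun b₀ p₀ g := mul_one_add_log_le_pFun hb₀ hp₀ hg0 hg1
  have hp0 : 0 ≤ b₀ * (1 + t) := by positivity
  have hpsq : (b₀ * (1 + t)) ^ 2 ≤ (B10.pFun b₀ p₀ g) ^ 2 := pow_le_pow_left₀ hp0 hp1 2
  -- STEP 1: `g^{−(N+8)}·exp(−c·p²) ≤ exp((N+8)²/(4c·b₀²))`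
  have hcb : 0 < c * b₀ ^ 2 := by positivity
  have hstep : g⁻¹ ^ (N + 8) * Real.exp (-(c * (B10.pFun b₀ p₀ g) ^ 2))
      ≤ Real.exp (((N : ℝ) + 8) ^ 2 / (4 * (c * b₀ ^ 2))) := by
    rw [hginv, ← Real.exp_nat_mul, ← Real.exp_add]
    refine Real.exp_le_exp.mpr ?_
    have hM : (0 : ℝ) ≤ (N : ℝ) + 8 := by positivity
    have hsq := linear_sub_sq_le (t := t) (M := (N : ℝ) + 8) hcb hM
    push_cast
    have : -(c * (B10.pFun b₀ p₀ g) ^ 2) ≤ -(c * b₀ ^ 2 * (1 + t) ^ 2) := by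
      have e : (b₀ * (1 + t)) ^ 2 = b₀ ^ 2 * (1 + t) ^ 2 := by ring
      rw [e] at hpsq
      nlinarith
    linarith
  -- STEP 2: `(L⁻⁴)^s = (g²/γ)⁴ ≥ g⁸`
  have hLs : (((L : ℝ) ^ 4)⁻¹) ^ s = (((L : ℝ)⁻¹) ^ s) ^ 4 := by
    rw [← inv_pow, pow_right_comm]
  have hLg : ((L : ℝ)⁻¹) ^ s = g ^ 2 / γ := by
    rw [hgsq, hq]
    field_simp
  have hg8 : g ^ 8 ≤ (((L : ℝ) ^ 4)⁻¹) ^ s := by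
    rw [hLs, hLg]
    have hγ4 : γ ^ 4 ≤ 1 := pow_le_one₀ hγ.le hγ1
    have hγ4pos : 0 < γ ^ 4 := pow_pos hγ 4
    rw [div_pow, le_div_iff₀ hγ4pos]
    calc g ^ 8 * γ ^ 4 ≤ g ^ 8 * 1 := mul_le_mul_of_nonneg_left hγ4 (by positivity)
      _ = (g ^ 2) ^ 4 := by ring
  -- assemble: LHS = (g⁻¹^(N+8)·exp) · g⁸
  have hsplit : g⁻¹ ^ N * Real.exp (-(c * (B10.pFun b₀ p₀ g) ^ 2))
      = (g⁻¹ ^ (N + 8) * Real.exp (-(c * (B10.pFun b₀ p₀ g) ^ 2))) * g ^ 8 := by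
    have h8 : g⁻¹ ^ 8 * g ^ 8 = 1 := by
      rw [← mul_pow, inv_mul_cancel₀ hg0.ne', one_pow]
    rw [pow_add]
    linear_combination (-(g⁻¹ ^ N * Real.exp (-(c * (B10.pFun b₀ p₀ g) ^ 2)))) * h8
  show g⁻¹ ^ N * Real.exp (-(c * (B10.pFun b₀ p₀ g) ^ 2))
      ≤ Real.exp (((N : ℝ) + 8) ^ 2 / (4 * (c * b₀ ^ 2))) * (((L : ℝ) ^ 4)⁻¹) ^ s
  rw [hsplit]
  exact mul_le_mul hstep hg8 (by positivity) (Real.exp_pos _).le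

/-- ★★★ **STUB D of the plan «pinned (41)» under the floor stub of line «entropy-floor» — the text of
`Cruxes/HistoryTailL/Lines/entropy_floor_planPinned41.lean` (plan v1.1) `stub_superpolyDoor` VERBATIM** (`2 < p₀` as printed there; only
`1 ≤ p₀` is used): for every `c > 0`, Bałaban's factor `g_s^{−N}·exp(−c·p(g_s)²)` is `≤ A·(L⁻⁴)^s` for some `A ≥ 0`, all `s`.
[cite: Balaban1985UV3, (7) p.257 and (70)-(71) p.273] -/
theorem stub_superpolyDoor :
    ∀ (L : ℕ), 1 < L → ∀ (γ b₀ p₀ c : ℝ), 0 < γ → γ ≤ 1 → 0 < b₀ → 2 < p₀ → 0 < c → ∀ N : ℕ, ∃ A : ℝ, 0 ≤ A ∧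
      ∀ s : ℕ, (Real.sqrt (γ * ((L : ℝ)⁻¹) ^ s))⁻¹ ^ N * Real.exp (-(c * B10.pFun b₀ p₀ (Real.sqrt (γ * ((L : ℝ)⁻¹) ^ s)) ^ 2))
        ≤ A * (((L : ℝ) ^ 4)⁻¹) ^ s := by
  intro L hL γ b₀ p₀ c hγ hγ1 hb₀ hp₀ hc N
  exact ⟨Real.exp (((N : ℝ) + 8) ^ 2 / (4 * (c * b₀ ^ 2))), (Real.exp_pos _).le,
    fun s => superpolyDoor_explicit L hL γ b₀ p₀ c hγ hγ1 hb₀ (by linarith) hc N s⟩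

end Summit.QuantumFields.YangMills.Theorems.EntropyFloorSuperpolyDoor

end
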